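import Summits.SmoothPoincare4.SmoothPoincare4.Theorems.ConvexBisectionAcyclicBisectionExistsHgapCharGlued
import Summits.SmoothPoincare4.SmoothPoincare4.Theorems.ConvexBisectionAcyclicBisectionExistsHgapCharRadial
import HarnessLib

/-!
# Hgap ▸ part B (page twisting of the straightened dual framed knot), brick H1-d (sphere ↔ tube side):
# the sign relation `sign χ = twistSign · sign χ_η` at a glued point and the net transfer
(wave 7, crux stmt-SmoothPoincare4-10508, line `modp-braid-orbits`, stub `stub_T3_dualPresentation` (T3)
▸ node `Hgap` ▸ part B `helper_Hgap_twisting` ▸ (R6b); registered sub-goal `helper_beltChar_glued`)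

Notation (`G2-REPORT.md` §4 (R6), `work/stubs/H1H2H3_interface.lean`): `Γ̂` the three-dimensional belt-tube
chart of the `j`-th handle pushed through the seam and the time-1 map `R₁` of a `rho`-preserving ambient
isotopy `R`, `χ (p) = det4 (∇rho (Γ̂ p), dΓ̂ e₀, dΓ̂ e₁, dΓ̂ e₂)` its orientation character;
`η̂ (p) = f♭ (circlePt (arg (toC (L p)) / 2π), ‖L p‖ • circlePt (p 2))` the tube-side map, `η♯ = val ∘ val ∘ η̂`,
`χ_η (p) = det4 (∇rho (η♯ p), dη♯ e₀, dη♯ e₁, dη♯ e₂)` its orientation character.  By `…HgapCharGlued.lean`,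
`dΓ̂ = bdDeriv (R₁ ∘ seamB) (η̂ p) ∘ dη♯` at glued points.  This file proves:

* §1 `χ_η (p) ≠ 0` at glued points (`tubeChar_ne_zero`: `dη♯` is injective because `dΓ̂` is, and tangent);
* §2 **the sign relation** `0 < twistSign (η̂ p) · χ (p) · χ_η (p)` at glued FLAT points (`beltChar_glued_sign`,
  registered `helper_beltChar_glued`): G3's `helper_twistSign_det4_flatten` for the tangent frame `dη♯ e`
  (transposed if `χ_η < 0`);
* §3 for the assembly (chart written with `E := R.toDiffeomorph 1` APPLIED, as in `…HgapCharRadial.lean`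
  and in H3's `HR6net`): the NET transfer `0 < -(s₀ ε) χ (p')` on the whole chart domain from the two
  tube-side signs at ONE glued point (`beltChar_net_of_glued`), and the existence of admissible glued points on
  the ray `L p = r e₀` (`exists_gluedPt`).

Everything is proved; no named facts, no `sorry`.  References: R. İ. Baykur, AGT 6 (2006), §2.3 [Baykur2006];
A. A. Kosinski, *Differential Manifolds* (1993), VI §6 [Kosinski1993].
-/

noncomputable section

set_option linter.dupNamespace false

open scoped Manifold ContDiff Topology RealInnerProductSpace
open Set Function Metric Filter Complex
open Literature.Topology.FourManifolds Literature.Topology.FourManifolds.HandleAttachingMap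
  Literature.Topology.FourManifolds.LefschetzBase Literature.Geometry.Symplectic

namespace Summit.SmoothPoincare4.SmoothPoincare4.Theorems.AcyclicBisectionExists.ModpBraidOrbits

/-- Transposing two of the last three slots changes the sign of `det4`. [folklore] -/
theorem det4_swap₁₂ (n a b c : EuclideanSpace ℝ (Fin 4)) : det4 n b a c = -det4 n a b c := by
  rw [det4_expand, det4_expand]; ring

section Sign

variable {g : ℕ} {ι : Type} [Finite ι] {h : ι → HandleAttachingMap 3 2 (Base g)}
  {X : Type} [TopologicalSpace X] [ChartedSpace (EuclideanHalfSpace 4) X] [IsManifold (𝓡∂ 4) ∞ X]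
  (D : MultiAttachmentData h (𝓡∂ 4) X) (bX : BoundaryData (𝓡∂ 4) X (𝓡 3)) [Nonempty bX.carrier]
  (Ψ : bX.carrier ≃ₘ⟮𝓡 3, 𝓡 3⟯ (bBase g).carrier) (R : AmbientIsotopy (𝓡∂ 4) (Base g)) (j : ι)
  {L : EuclideanSpace ℝ (Fin 3) →L[ℝ] EuclideanSpace ℝ (Fin 2)}

/-! ## §1 The tube-side character never vanishes at glued points -/

include D bX Ψ in
/-- **The tube-side character never vanishes at a glued point**: `χ_η (p) ≠ 0` for `toC (L p)` in the slit
plane and `‖L p‖ < 1` — `dη♯` is injective (because `dΓ̂ = bdDeriv seamB ∘ dη♯` is, for the chart with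
`E = id`) with tangent columns, and `∇rho ≠ 0` is normal (the fibred model `D, bX, Ψ` only enters the proof).
[cite: Kosinski1993, VI §6] -/
theorem tubeChar_ne_zero
    (hL : ∀ (p : EuclideanSpace ℝ (Fin 3)) (i : Fin 2), L p i = p (Fin.castSucc i))
    (p : EuclideanSpace ℝ (Fin 3)) (hslit : toC (L p) ∈ Complex.slitPlane) (hp : ‖L p‖ < 1) :
    det4 (gradient (rho g) ((((h j).boundaryTube.toHomeo (circlePt (Complex.arg (toC (L p)) / (2 * Real.pi)),
          ‖L p‖ • ((circlePt (p 2) : sphere (0 : EuclideanSpace ℝ (Fin 2)) 1) : EuclideanSpace ℝ (Fin 2)))).1).1))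
      (mfderiv 𝓘(ℝ, EuclideanSpace ℝ (Fin 3)) 𝓘(ℝ, EuclideanSpace ℝ (Fin 4)) (fun p : EuclideanSpace ℝ (Fin 3) =>
        ((((h j).boundaryTube.toHomeo (circlePt (Complex.arg (toC (L p)) / (2 * Real.pi)),
          ‖L p‖ • ((circlePt (p 2) : sphere (0 : EuclideanSpace ℝ (Fin 2)) 1) : EuclideanSpace ℝ (Fin 2)))).1).1 :
            EuclideanSpace ℝ (Fin 4))) p (EuclideanSpace.single (0 : Fin 3) (1 : ℝ)))
      (mfderiv 𝓘(ℝ, EuclideanSpace ℝ (Fin 3)) 𝓘(ℝ, EuclideanSpace ℝ (Fin 4)) (fun p : EuclideanSpace ℝ (Fin 3) =>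
        ((((h j).boundaryTube.toHomeo (circlePt (Complex.arg (toC (L p)) / (2 * Real.pi)),
          ‖L p‖ • ((circlePt (p 2) : sphere (0 : EuclideanSpace ℝ (Fin 2)) 1) : EuclideanSpace ℝ (Fin 2)))).1).1 :
            EuclideanSpace ℝ (Fin 4))) p (EuclideanSpace.single (1 : Fin 3) (1 : ℝ)))
      (mfderiv 𝓘(ℝ, EuclideanSpace ℝ (Fin 3)) 𝓘(ℝ, EuclideanSpace ℝ (Fin 4)) (fun p : EuclideanSpace ℝ (Fin 3) =>
        ((((h j).boundaryTube.toHomeo (circlePt (Complex.arg (toC (L p)) / (2 * Real.pi)),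
          ‖L p‖ • ((circlePt (p 2) : sphere (0 : EuclideanSpace ℝ (Fin 2)) 1) : EuclideanSpace ℝ (Fin 2)))).1).1 :
            EuclideanSpace ℝ (Fin 4))) p (EuclideanSpace.single (2 : Fin 3) (1 : ℝ))) ≠ 0 := by
  obtain ⟨W, hW⟩ : ∃ W : EuclideanSpace ℝ (Fin 3) →L[ℝ] EuclideanSpace ℝ (Fin 4), ∀ u,
      mfderiv 𝓘(ℝ, EuclideanSpace ℝ (Fin 3)) 𝓘(ℝ, EuclideanSpace ℝ (Fin 4)) (fun p : EuclideanSpace ℝ (Fin 3) =>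
        ((((h j).boundaryTube.toHomeo (circlePt (Complex.arg (toC (L p)) / (2 * Real.pi)),
          ‖L p‖ • ((circlePt (p 2) : sphere (0 : EuclideanSpace ℝ (Fin 2)) 1) : EuclideanSpace ℝ (Fin 2)))).1).1 :
            EuclideanSpace ℝ (Fin 4))) p u = W u :=
    ⟨_, fun u => rfl⟩
  have hE : ContMDiff (𝓡∂ 4) (𝓡∂ 4) ∞ (Diffeomorph.refl (𝓡∂ 4) (Base g) ∞ : Base g → Base g) :=
    (Diffeomorph.refl (𝓡∂ 4) (Base g) ∞).contMDiff
  have hfac := fun u => mfderiv_beltChart₃_glued D bX Ψ (Diffeomorph.refl (𝓡∂ 4) (Base g) ∞ : Base g → Base g)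
    j hE p hslit hp u
  have hinj := injective_mfderiv_beltChart₃ D bX Ψ (Diffeomorph.refl (𝓡∂ 4) (Base g) ∞) j hL p hp
  have hWi : Injective W := fun u v huv => hinj (by rw [hfac u, hfac v, hW, hW, huv])
  rw [hW, hW, hW]
  have hn := gradient_rho_ne_zero _ (rho_tubeChart (g := g) (h := h) (L := L) j p)
  refine det4_ne_zero_of_normal_frame _ (fun k => W (EuclideanSpace.single k (1 : ℝ))) hn (fun k => ?_) ?_
  · rw [inner_gradient_eq_fderiv, ← hW]
    exact fderiv_rho_tubeChart (g := g) j p hslit hp _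
  · have hb : LinearIndependent ℝ (fun k : Fin 3 => EuclideanSpace.single k (1 : ℝ)) := by
      have h0 := (EuclideanSpace.basisFun (Fin 3) ℝ).toBasis.linearIndependent
      rw [OrthonormalBasis.coe_toBasis] at h0
      have e : (fun k : Fin 3 => EuclideanSpace.single k (1 : ℝ)) = ⇑(EuclideanSpace.basisFun (Fin 3) ℝ) := by
        funext k
        exact (EuclideanSpace.basisFun_apply (Fin 3) ℝ k).symm
      rw [e]; exact h0
    exact hb.map' (W : EuclideanSpace ℝ (Fin 3) →ₗ[ℝ] EuclideanSpace ℝ (Fin 4)) (LinearMap.ker_eq_bot.2 hWi)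

/-! ## §2 The sign relation at a glued flat point -/

/-- **The sign relation at a glued flat point** (brick H1-d): for a fibred model with the page clause and a
`rho`-preserving ambient isotopy `R`, at `p` with `toC (L p)` in the slit plane, `‖L p‖ < 1` and `η♯ p`
flat, `0 < twistSign (η̂ p) · χ (p) · χ_η (p)` — i.e. `sign χ = twistSign · sign χ_η`.
[cite: Baykur2006, §2.3] -/
theorem beltChar_glued_sign
    (hpage : ∀ (y : bX.carrier) (a : ↥(coresComplement h)), bX.incl y = D.jA a →
      ∃ c : ℝ, 0 < c ∧ w g ((bBase g).incl (Ψ y)).1 = (c : ℂ) * w g (a : Base g).1)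
    (hρR : ∀ (t : ℝ) (x : Base g), rho g (R.toFun t x).1 = rho g x.1)
    (hL : ∀ (p : EuclideanSpace ℝ (Fin 3)) (i : Fin 2), L p i = p (Fin.castSucc i))
    (p : EuclideanSpace ℝ (Fin 3)) (hslit : toC (L p) ∈ Complex.slitPlane) (hp : ‖L p‖ < 1)
    (hflat : ‖cx ((((h j).boundaryTube.toHomeo (circlePt (Complex.arg (toC (L p)) / (2 * Real.pi)),
      ‖L p‖ • ((circlePt (p 2) : sphere (0 : EuclideanSpace ℝ (Fin 2)) 1) : EuclideanSpace ℝ (Fin 2)))).1).1)‖ ^ 2 < 4) :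
    0 < (twistSign D bX Ψ ((h j).boundaryTube.toHomeo (circlePt (Complex.arg (toC (L p)) / (2 * Real.pi)),
          ‖L p‖ • ((circlePt (p 2) : sphere (0 : EuclideanSpace ℝ (Fin 2)) 1) : EuclideanSpace ℝ (Fin 2)))) : ℝ) *
      det4 (gradient (rho g) (R.toDiffeomorph 1 ((BoundaryManifold.boundaryData 3 (Base g)).incl (seamDiffeo bX (bBase g) Ψ
          ((beltMap D j).boundaryTube.toHomeo (circlePt (p 2), L p))))).1)
        (mfderiv 𝓘(ℝ, EuclideanSpace ℝ (Fin 3)) 𝓘(ℝ, EuclideanSpace ℝ (Fin 4))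
          (fun p : EuclideanSpace ℝ (Fin 3) => (R.toDiffeomorph 1 ((BoundaryManifold.boundaryData 3 (Base g)).incl
            (seamDiffeo bX (bBase g) Ψ ((beltMap D j).boundaryTube.toHomeo (circlePt (p 2), L p))))).1) p
          (EuclideanSpace.single (0 : Fin 3) (1 : ℝ)))
        (mfderiv 𝓘(ℝ, EuclideanSpace ℝ (Fin 3)) 𝓘(ℝ, EuclideanSpace ℝ (Fin 4))
          (fun p : EuclideanSpace ℝ (Fin 3) => (R.toDiffeomorph 1 ((BoundaryManifold.boundaryData 3 (Base g)).incl
            (seamDiffeo bX (bBase g) Ψ ((beltMap D j).boundaryTube.toHomeo (circlePt (p 2), L p))))).1) p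
          (EuclideanSpace.single (1 : Fin 3) (1 : ℝ)))
        (mfderiv 𝓘(ℝ, EuclideanSpace ℝ (Fin 3)) 𝓘(ℝ, EuclideanSpace ℝ (Fin 4))
          (fun p : EuclideanSpace ℝ (Fin 3) => (R.toDiffeomorph 1 ((BoundaryManifold.boundaryData 3 (Base g)).incl
            (seamDiffeo bX (bBase g) Ψ ((beltMap D j).boundaryTube.toHomeo (circlePt (p 2), L p))))).1) p
          (EuclideanSpace.single (2 : Fin 3) (1 : ℝ))) *
      det4 (gradient (rho g) ((((h j).boundaryTube.toHomeo (circlePt (Complex.arg (toC (L p)) / (2 * Real.pi)),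
          ‖L p‖ • ((circlePt (p 2) : sphere (0 : EuclideanSpace ℝ (Fin 2)) 1) : EuclideanSpace ℝ (Fin 2)))).1).1))
        (mfderiv 𝓘(ℝ, EuclideanSpace ℝ (Fin 3)) 𝓘(ℝ, EuclideanSpace ℝ (Fin 4)) (fun p : EuclideanSpace ℝ (Fin 3) =>
          ((((h j).boundaryTube.toHomeo (circlePt (Complex.arg (toC (L p)) / (2 * Real.pi)),
            ‖L p‖ • ((circlePt (p 2) : sphere (0 : EuclideanSpace ℝ (Fin 2)) 1) : EuclideanSpace ℝ (Fin 2)))).1).1 :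
              EuclideanSpace ℝ (Fin 4))) p (EuclideanSpace.single (0 : Fin 3) (1 : ℝ)))
        (mfderiv 𝓘(ℝ, EuclideanSpace ℝ (Fin 3)) 𝓘(ℝ, EuclideanSpace ℝ (Fin 4)) (fun p : EuclideanSpace ℝ (Fin 3) =>
          ((((h j).boundaryTube.toHomeo (circlePt (Complex.arg (toC (L p)) / (2 * Real.pi)),
            ‖L p‖ • ((circlePt (p 2) : sphere (0 : EuclideanSpace ℝ (Fin 2)) 1) : EuclideanSpace ℝ (Fin 2)))).1).1 :
              EuclideanSpace ℝ (Fin 4))) p (EuclideanSpace.single (1 : Fin 3) (1 : ℝ)))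
        (mfderiv 𝓘(ℝ, EuclideanSpace ℝ (Fin 3)) 𝓘(ℝ, EuclideanSpace ℝ (Fin 4)) (fun p : EuclideanSpace ℝ (Fin 3) =>
          ((((h j).boundaryTube.toHomeo (circlePt (Complex.arg (toC (L p)) / (2 * Real.pi)),
            ‖L p‖ • ((circlePt (p 2) : sphere (0 : EuclideanSpace ℝ (Fin 2)) 1) : EuclideanSpace ℝ (Fin 2)))).1).1 :
              EuclideanSpace ℝ (Fin 4))) p (EuclideanSpace.single (2 : Fin 3) (1 : ℝ))) := by
  have hne := tubeChar_ne_zero D bX Ψ j hL p hslit hp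
  obtain ⟨W, hW⟩ : ∃ W : EuclideanSpace ℝ (Fin 3) →L[ℝ] EuclideanSpace ℝ (Fin 4), ∀ u,
      mfderiv 𝓘(ℝ, EuclideanSpace ℝ (Fin 3)) 𝓘(ℝ, EuclideanSpace ℝ (Fin 4)) (fun p : EuclideanSpace ℝ (Fin 3) =>
        ((((h j).boundaryTube.toHomeo (circlePt (Complex.arg (toC (L p)) / (2 * Real.pi)),
          ‖L p‖ • ((circlePt (p 2) : sphere (0 : EuclideanSpace ℝ (Fin 2)) 1) : EuclideanSpace ℝ (Fin 2)))).1).1 :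
            EuclideanSpace ℝ (Fin 4))) p u = W u :=
    ⟨_, fun u => rfl⟩
  have h0 : L p ≠ 0 := ne_zero_of_toC_mem_slitPlane hslit
  have hr0 : 0 < ‖L p‖ := norm_pos_iff.2 h0
  have hE : ContMDiff (𝓡∂ 4) (𝓡∂ 4) ∞ (R.toDiffeomorph 1 : Base g → Base g) := (R.toDiffeomorph 1).contMDiff
  have hfac := fun u => mfderiv_beltChart₃_glued D bX Ψ (R.toDiffeomorph 1 : Base g → Base g) j hE p hslit hp u
  have hpt := beltChart₃_eq_seamB_tubeMap D bX Ψ (R.toDiffeomorph 1 : Base g → Base g) j p h0 hp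
  have hy : ((((h j).boundaryTube.toHomeo (circlePt (Complex.arg (toC (L p)) / (2 * Real.pi)),
      ‖L p‖ • ((circlePt (p 2) : sphere (0 : EuclideanSpace ℝ (Fin 2)) 1) : EuclideanSpace ℝ (Fin 2)))).1 :
        Base g)) ∈ coresComplement h :=
    tubePt_mem_coresComplement D j _ _ hr0 hp
  have hV : ∀ u, fderiv ℝ (rho g) ((((h j).boundaryTube.toHomeo (circlePt (Complex.arg (toC (L p)) / (2 * Real.pi)),
      ‖L p‖ • ((circlePt (p 2) : sphere (0 : EuclideanSpace ℝ (Fin 2)) 1) : EuclideanSpace ℝ (Fin 2)))).1).1)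
        (W u) = 0 := fun u => by
    rw [← hW]; exact fderiv_rho_tubeChart (g := g) j p hslit hp u
  rw [hW, hW, hW] at hne ⊢
  rw [hfac, hfac, hfac, hW, hW, hW, hpt]
  rcases lt_or_gt_of_ne hne with hneg | hpos
  · -- transpose the first two columns
    have hpos' : 0 < det4 (gradient (rho g) ((((h j).boundaryTube.toHomeo
        (circlePt (Complex.arg (toC (L p)) / (2 * Real.pi)),
          ‖L p‖ • ((circlePt (p 2) : sphere (0 : EuclideanSpace ℝ (Fin 2)) 1) : EuclideanSpace ℝ (Fin 2)))).1).1))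
        (W (EuclideanSpace.single (1 : Fin 3) (1 : ℝ))) (W (EuclideanSpace.single (0 : Fin 3) (1 : ℝ)))
        (W (EuclideanSpace.single (2 : Fin 3) (1 : ℝ))) := by
      rw [det4_swap₁₂]; linarith
    have key := twistSign_mul_det4_flatten_pos D bX Ψ hpage R hρR hy hflat
      ![W (EuclideanSpace.single (1 : Fin 3) (1 : ℝ)), W (EuclideanSpace.single (0 : Fin 3) (1 : ℝ)),
        W (EuclideanSpace.single (2 : Fin 3) (1 : ℝ))]
      (fun k => by fin_cases k <;> exact hV _) hpos'
    simp only [Function.comp_apply, Matrix.cons_val_zero, Matrix.cons_val_one, Matrix.cons_val] at key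
    rw [det4_swap₁₂, mul_neg] at key
    exact mul_pos_of_neg_of_neg (neg_pos.1 key) hneg
  · have key := twistSign_mul_det4_flatten_pos D bX Ψ hpage R hρR hy hflat
      (fun k => W (EuclideanSpace.single k (1 : ℝ))) (fun k => hV _) hpos
    simp only [Function.comp_apply] at key
    exact mul_pos key hpos


/-! ## §3 For the assembly: the net transfer and admissible glued points -/

/-- Sign bookkeeping of the net transfer: `0 < t A B`, `0 < -e B`, `t = s`, `0 < A A'` give `0 < -(s e) A'`.
[folklore] -/
theorem net_sign_algebra {t s e A A' B : ℝ} (h1 : 0 < t * A * B) (h2 : 0 < -e * B) (h3 : t = s)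
    (h4 : 0 < A * A') : 0 < -(s * e) * A' := by
  subst h3
  have hB : B ≠ 0 := by rintro rfl; simp at h2
  have hc : 0 < t * A * -e := by
    rcases lt_or_gt_of_ne hB with hB' | hB'
    · have ha : t * A < 0 := by
        rcases mul_pos_iff.1 h1 with ⟨-, hb⟩ | ⟨ha, -⟩
        · exact absurd hb (not_lt.2 hB'.le)
        · exact ha
      have he : -e < 0 := by
        rcases mul_pos_iff.1 h2 with ⟨-, hb⟩ | ⟨he, -⟩
        · exact absurd hb (not_lt.2 hB'.le)
        · exact he
      exact mul_pos_of_neg_of_neg ha he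
    · have ha : 0 < t * A := (pos_iff_pos_of_mul_pos h1).2 hB'
      have he : 0 < -e := (pos_iff_pos_of_mul_pos h2).2 hB'
      exact mul_pos ha he
  have h5 : 0 < -(t * e) * A' * (A * A) := by
    have : -(t * e) * A' * (A * A) = (t * A * -e) * (A * A') := by ring
    rw [this]; exact mul_pos hc h4
  exact pos_of_mul_pos_left h5 (mul_self_nonneg A)

/-- **The net transfer** (G2-REPORT §4 (R6) "Net"): if at ONE glued flat point `p` the tube side supplies
`0 < -e · χ_η (p)` (H2's (R6c)) and `twistSign (η̂ p) = s` (X3's global sign via `hS0`), then the orientation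
character of the chart has the sign `-(s e)` on the WHOLE chart domain: `0 < -(s e) · χ (p')` for `‖L p'‖ < 1`.
[cite: Baykur2006, §2.3] -/
theorem beltChar_net_of_glued
    (hpage : ∀ (y : bX.carrier) (a : ↥(coresComplement h)), bX.incl y = D.jA a →
      ∃ c : ℝ, 0 < c ∧ w g ((bBase g).incl (Ψ y)).1 = (c : ℂ) * w g (a : Base g).1)
    (hρR : ∀ (t : ℝ) (x : Base g), rho g (R.toFun t x).1 = rho g x.1)
    (hL : ∀ (p : EuclideanSpace ℝ (Fin 3)) (i : Fin 2), L p i = p (Fin.castSucc i))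
    (p : EuclideanSpace ℝ (Fin 3)) (hslit : toC (L p) ∈ Complex.slitPlane) (hp : ‖L p‖ < 1)
    (hflat : ‖cx ((((h j).boundaryTube.toHomeo (circlePt (Complex.arg (toC (L p)) / (2 * Real.pi)),
      ‖L p‖ • ((circlePt (p 2) : sphere (0 : EuclideanSpace ℝ (Fin 2)) 1) : EuclideanSpace ℝ (Fin 2)))).1).1)‖ ^ 2 < 4)
    {s e : ℝ}
    (hs : (twistSign D bX Ψ ((h j).boundaryTube.toHomeo (circlePt (Complex.arg (toC (L p)) / (2 * Real.pi)),
      ‖L p‖ • ((circlePt (p 2) : sphere (0 : EuclideanSpace ℝ (Fin 2)) 1) : EuclideanSpace ℝ (Fin 2)))) : ℝ) = s)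
    (he : 0 < -e *
      det4 (gradient (rho g) ((((h j).boundaryTube.toHomeo (circlePt (Complex.arg (toC (L p)) / (2 * Real.pi)),
          ‖L p‖ • ((circlePt (p 2) : sphere (0 : EuclideanSpace ℝ (Fin 2)) 1) : EuclideanSpace ℝ (Fin 2)))).1).1))
        (mfderiv 𝓘(ℝ, EuclideanSpace ℝ (Fin 3)) 𝓘(ℝ, EuclideanSpace ℝ (Fin 4)) (fun p : EuclideanSpace ℝ (Fin 3) =>
          ((((h j).boundaryTube.toHomeo (circlePt (Complex.arg (toC (L p)) / (2 * Real.pi)),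
            ‖L p‖ • ((circlePt (p 2) : sphere (0 : EuclideanSpace ℝ (Fin 2)) 1) : EuclideanSpace ℝ (Fin 2)))).1).1 :
              EuclideanSpace ℝ (Fin 4))) p (EuclideanSpace.single (0 : Fin 3) (1 : ℝ)))
        (mfderiv 𝓘(ℝ, EuclideanSpace ℝ (Fin 3)) 𝓘(ℝ, EuclideanSpace ℝ (Fin 4)) (fun p : EuclideanSpace ℝ (Fin 3) =>
          ((((h j).boundaryTube.toHomeo (circlePt (Complex.arg (toC (L p)) / (2 * Real.pi)),
            ‖L p‖ • ((circlePt (p 2) : sphere (0 : EuclideanSpace ℝ (Fin 2)) 1) : EuclideanSpace ℝ (Fin 2)))).1).1 :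
              EuclideanSpace ℝ (Fin 4))) p (EuclideanSpace.single (1 : Fin 3) (1 : ℝ)))
        (mfderiv 𝓘(ℝ, EuclideanSpace ℝ (Fin 3)) 𝓘(ℝ, EuclideanSpace ℝ (Fin 4)) (fun p : EuclideanSpace ℝ (Fin 3) =>
          ((((h j).boundaryTube.toHomeo (circlePt (Complex.arg (toC (L p)) / (2 * Real.pi)),
            ‖L p‖ • ((circlePt (p 2) : sphere (0 : EuclideanSpace ℝ (Fin 2)) 1) : EuclideanSpace ℝ (Fin 2)))).1).1 :
              EuclideanSpace ℝ (Fin 4))) p (EuclideanSpace.single (2 : Fin 3) (1 : ℝ))))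
    (p' : EuclideanSpace ℝ (Fin 3)) (hp' : ‖L p'‖ < 1) :
    0 < -(s * e) *
      det4 (gradient (rho g) (R.toDiffeomorph 1 ((BoundaryManifold.boundaryData 3 (Base g)).incl (seamDiffeo bX (bBase g) Ψ
          ((beltMap D j).boundaryTube.toHomeo (circlePt (p' 2), L p'))))).1)
        (mfderiv 𝓘(ℝ, EuclideanSpace ℝ (Fin 3)) 𝓘(ℝ, EuclideanSpace ℝ (Fin 4))
          (fun p : EuclideanSpace ℝ (Fin 3) => (R.toDiffeomorph 1 ((BoundaryManifold.boundaryData 3 (Base g)).incl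
            (seamDiffeo bX (bBase g) Ψ ((beltMap D j).boundaryTube.toHomeo (circlePt (p 2), L p))))).1) p'
          (EuclideanSpace.single (0 : Fin 3) (1 : ℝ)))
        (mfderiv 𝓘(ℝ, EuclideanSpace ℝ (Fin 3)) 𝓘(ℝ, EuclideanSpace ℝ (Fin 4))
          (fun p : EuclideanSpace ℝ (Fin 3) => (R.toDiffeomorph 1 ((BoundaryManifold.boundaryData 3 (Base g)).incl
            (seamDiffeo bX (bBase g) Ψ ((beltMap D j).boundaryTube.toHomeo (circlePt (p 2), L p))))).1) p'
          (EuclideanSpace.single (1 : Fin 3) (1 : ℝ)))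
        (mfderiv 𝓘(ℝ, EuclideanSpace ℝ (Fin 3)) 𝓘(ℝ, EuclideanSpace ℝ (Fin 4))
          (fun p : EuclideanSpace ℝ (Fin 3) => (R.toDiffeomorph 1 ((BoundaryManifold.boundaryData 3 (Base g)).incl
            (seamDiffeo bX (bBase g) Ψ ((beltMap D j).boundaryTube.toHomeo (circlePt (p 2), L p))))).1) p'
          (EuclideanSpace.single (2 : Fin 3) (1 : ℝ))) :=
  net_sign_algebra (beltChar_glued_sign D bX Ψ R j hpage hρR hL p hslit hp hflat) he hs
    (beltChar_sign_const D bX Ψ (R.toDiffeomorph 1) j hL (hρR 1) p p' hp hp')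

omit [Finite ι] [Nonempty bX.carrier] in
/-- **Admissible glued points on the ray `L p = r e₀`**: for every angle `φ` and every `r₀ > 0` there is a
point `p = (r, 0, φ)`, `0 < r < min r₀ 1` (`L p = single 0 r = r • planeE0`), of the chart domain with
`toC (L p) = r` in the slit plane and
`η♯ (p)` FLAT — the tube-side point tends to the attaching circle point `K (circlePt 0)`, which lies in the
flat page `page g c`, as `r → 0`. [cite: Kosinski1993, VI §6] -/
theorem exists_gluedPt
    (hL : ∀ (p : EuclideanSpace ℝ (Fin 3)) (i : Fin 2), L p i = p (Fin.castSucc i)) {c : ℂ}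
    (hKc : ∀ v, (h j).attachingCircle v ∈ page g c) (φ r₀ : ℝ) (hr₀ : 0 < r₀) :
    ∃ p : EuclideanSpace ℝ (Fin 3), p 2 = φ ∧ L p = EuclideanSpace.single (0 : Fin 2) (‖L p‖) ∧
      L p = ‖L p‖ • planeE0 ∧ 0 < ‖L p‖ ∧ ‖L p‖ < r₀ ∧ ‖L p‖ < 1 ∧ toC (L p) ∈ Complex.slitPlane ∧
      ‖cx ((((h j).boundaryTube.toHomeo (circlePt (Complex.arg (toC (L p)) / (2 * Real.pi)),
        ‖L p‖ • ((circlePt (p 2) : sphere (0 : EuclideanSpace ℝ (Fin 2)) 1) : EuclideanSpace ℝ (Fin 2)))).1).1)‖ ^ 2 < 4 := by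
  -- the tube-side point along the ray, as a function of `r`
  set F : ℝ → EuclideanSpace ℝ (Fin 4) := fun r => (((h j).boundaryTube.toHomeo (circlePt 0,
    r • ((circlePt φ : sphere (0 : EuclideanSpace ℝ (Fin 2)) 1) : EuclideanSpace ℝ (Fin 2)))).1).1 with hF
  have hsrc : ((circlePt 0, (0 : ℝ) • ((circlePt φ : sphere (0 : EuclideanSpace ℝ (Fin 2)) 1) :
      EuclideanSpace ℝ (Fin 2))) : (sphere (0 : EuclideanSpace ℝ (Fin 2)) 1) × EuclideanSpace ℝ (Fin 2)) ∈
        (h j).boundaryTube.toHomeo.source := by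
    rw [CircleTube.mem_source_iff, zero_smul, norm_zero]; exact one_pos
  have hcont : ContinuousAt F 0 := by
    have h1 : ContinuousAt (fun r : ℝ => ((circlePt 0, r • ((circlePt φ : sphere (0 : EuclideanSpace ℝ (Fin 2)) 1) :
        EuclideanSpace ℝ (Fin 2))) : (sphere (0 : EuclideanSpace ℝ (Fin 2)) 1) × EuclideanSpace ℝ (Fin 2))) 0 :=
      (continuous_const.prodMk (continuous_id.smul continuous_const)).continuousAt
    have h2 : ContinuousAt (h j).boundaryTube.toHomeo _ :=
      (h j).boundaryTube.toHomeo.continuousOn.continuousAt ((h j).boundaryTube.isOpen_source.mem_nhds hsrc)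
    have h3 : Continuous (fun y : (bBase g).carrier => ((y.1).1 : EuclideanSpace ℝ (Fin 4))) :=
      continuous_subtype_val.comp continuous_subtype_val
    exact h3.continuousAt.comp (h2.comp_of_eq h1 rfl)
  have hF0 : ‖cx (F 0)‖ ^ 2 < 4 := by
    have e : F 0 = ((h j).attachingCircle (circlePt 0)).1 := by
      rw [hF]
      simp only [zero_smul]
      rw [← CircleTube.core_apply, HandleAttachingMap.coe_boundaryTube_core]
    rw [e]; exact (hKc _).1
  have hopen : IsOpen {q : EuclideanSpace ℝ (Fin 4) | ‖cx q‖ ^ 2 < 4} :=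
    isOpen_lt ((continuous_norm.comp contDiff_cx.continuous).pow 2) continuous_const
  have hev : ∀ᶠ r in 𝓝[>] (0 : ℝ), ‖cx (F r)‖ ^ 2 < 4 :=
    (hcont.eventually_mem (hopen.mem_nhds hF0)).filter_mono nhdsWithin_le_nhds
  have hev' : ∀ᶠ r in 𝓝[>] (0 : ℝ), r ∈ Ioo (0 : ℝ) (min r₀ 1) := Ioo_mem_nhdsGT (lt_min hr₀ one_pos)
  obtain ⟨r, hr, hrI⟩ := (hev.and hev').exists
  have hr0 : 0 < r := hrI.1
  have hr1 : r < 1 := hrI.2.trans_le (min_le_right _ _)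
  have hrr : r < r₀ := hrI.2.trans_le (min_le_left _ _)
  -- the point `p = (r, 0, φ)`
  refine ⟨EuclideanSpace.single (0 : Fin 3) r + EuclideanSpace.single (2 : Fin 3) φ, ?_⟩
  have hLp : L (EuclideanSpace.single (0 : Fin 3) r + EuclideanSpace.single (2 : Fin 3) φ) =
      EuclideanSpace.single (0 : Fin 2) r := by
    ext i; rw [hL]; fin_cases i <;> simp
  have hnorm : ‖EuclideanSpace.single (0 : Fin 2) r‖ = r := by
    rw [PiLp.norm_single, Real.norm_eq_abs, abs_of_pos hr0]
  have htoC : toC (EuclideanSpace.single (0 : Fin 2) r) = (r : ℂ) := by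
    apply Complex.ext <;> simp [toC]
  have h2 : (EuclideanSpace.single (0 : Fin 3) r + EuclideanSpace.single (2 : Fin 3) φ) 2 = φ := by simp
  rw [hLp, hnorm, htoC, h2, Complex.arg_ofReal_of_nonneg hr0.le, zero_div]
  refine ⟨rfl, rfl, ?_, hr0, hrr, hr1, Complex.ofReal_mem_slitPlane.2 hr0, hr⟩
  ext i; fin_cases i <;> simp [planeE0]

end Sign

/-- **Sub-goal `helper_beltChar_glued` of stub `stub_T3_dualPresentation`** (T3 ▸ node `Hgap` ▸ part B
`helper_Hgap_twisting` ▸ transfer step (R6b), the sign relation; wave 7, lead c5, worker H1): at a glued flat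
point the `det4`-orientation characters `χ` of the three-dimensional belt-tube chart (time-1 map of a
`rho`-preserving ambient isotopy `R`) and `χ_η` of the tube-side map
`η̂ (p) = f♭ (circlePt (arg (toC (L p)) / 2π), ‖L p‖ • circlePt (p 2))` satisfy
`0 < twistSign (η̂ p) · χ (p) · χ_η (p)` (`let`-form of `beltChar_glued_sign`, chart written with `R.toFun 1`,
which is `rfl`-equal to `⇑(R.toDiffeomorph 1)`). [cite: Baykur2006, §2.3] -/
theorem helper_beltChar_glued : ∀ (g : ℕ) (ι : Type) [Finite ι] (h : ι → Literature.Topology.FourManifolds.HandleAttachingMap 3 2 (Literature.Topology.FourManifolds.LefschetzBase.Base g)) (X : Type) [TopologicalSpace X] [ChartedSpace (EuclideanHalfSpace 4) X] [IsManifold (𝓡∂ 4) ∞ X] (D : Literature.Topology.FourManifolds.HandleAttachingMap.MultiAttachmentData h (𝓡∂ 4) X) (bX : Literature.Topology.FourManifolds.BoundaryData (𝓡∂ 4) X (𝓡 3)) [Nonempty bX.carrier] (Ψ : bX.carrier ≃ₘ⟮𝓡 3, 𝓡 3⟯ (Literature.Topology.FourManifolds.LefschetzBase.bBase g).carrier),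 (∀ (y : bX.carrier) (a : ↥(Literature.Topology.FourManifolds.HandleAttachingMap.coresComplement h)), bX.incl y = D.jA a → ∃ c : ℝ, 0 < c ∧ Literature.Topology.FourManifolds.LefschetzBase.w g ((Literature.Topology.FourManifolds.LefschetzBase.bBase g).incl (Ψ y)).1 = (c : ℂ) * Literature.Topology.FourManifolds.LefschetzBase.w g (a : Literature.Topology.FourManifolds.LefschetzBase.Base g).1) → ∀ (R : Literature.Topology.FourManifolds.AmbientIsotopy (𝓡∂ 4) (Literature.Topology.FourManifolds.LefschetzBase.Base g)), (∀ (t : ℝ) (x : Literature.Topology.FourManifolds.LefschetzBase.Base g), Literature.Topology.FourManifolds.LefschetzBase.rho g (R.toFun t x).1 = Literature.Topology.FourManifolds.LefschetzBase.rho g x.1) → ∀ (j : ι) (L : EuclideanSpace ℝ (Fin 3) →L[ℝ] EuclideanSpace ℝ (Fin 2)), (∀ (p : EuclideanSpace ℝ (Fin 3)) (i : Fin 2), L p i = p (Fin.castSucc i)) → ∀ (p : EuclideanSpace ℝ (Fin 3)), Literature.Topology.FourManifolds.toC (L p) ∈ Complex.slitPlane → ‖L p‖ < 1 → let Γ : EuclideanSpace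 ℝ (Fin 3) → EuclideanSpace ℝ (Fin 4) := fun p => (R.toFun 1 ((Literature.Topology.FourManifolds.BoundaryManifold.boundaryData 3 (Literature.Topology.FourManifolds.LefschetzBase.Base g)).incl (Summit.SmoothPoincare4.SmoothPoincare4.Theorems.AcyclicBisectionExists.ModpBraidOrbits.seamDiffeo bX (Literature.Topology.FourManifolds.LefschetzBase.bBase g) Ψ ((Summit.SmoothPoincare4.SmoothPoincare4.Theorems.AcyclicBisectionExists.ModpBraidOrbits.beltMap D j).boundaryTube.toHomeo (Literature.Topology.FourManifolds.circlePt (p 2), L p))))).1; let ηm : EuclideanSpace ℝ (Fin 3) → (Literature.Topology.FourManifolds.LefschetzBase.bBase g).carrier := fun p => (h j).boundaryTube.toHomeo (Literature.Topology.FourManifolds.circlePt (Complex.arg (Literature.Topology.FourManifolds.toC (L p)) / (2 * Real.pi)), ‖L p‖ • ((Literature.Topology.FourManifolds.circlePt (p 2) : Metric.sphere (0 : EuclideanSpace ℝ (Fin 2)) 1) : EuclideanSpace ℝ (Fin 2))); let ηs : EuclideanSpace ℝ (Fin 3) → EuclideanSpace ℝ (Fin 4) := fun p => ((ηm p).1).1;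 ‖Literature.Topology.FourManifolds.LefschetzBase.cx (ηs p)‖ ^ 2 < 4 → 0 < (Summit.SmoothPoincare4.SmoothPoincare4.Theorems.AcyclicBisectionExists.ModpBraidOrbits.twistSign D bX Ψ (ηm p) : ℝ) * Literature.Geometry.Symplectic.det4 (gradient (Literature.Topology.FourManifolds.LefschetzBase.rho g) (Γ p)) (mfderiv 𝓘(ℝ, EuclideanSpace ℝ (Fin 3)) 𝓘(ℝ, EuclideanSpace ℝ (Fin 4)) Γ p (EuclideanSpace.single (0 : Fin 3) (1 : ℝ))) (mfderiv 𝓘(ℝ, EuclideanSpace ℝ (Fin 3)) 𝓘(ℝ, EuclideanSpace ℝ (Fin 4)) Γ p (EuclideanSpace.single (1 : Fin 3) (1 : ℝ))) (mfderiv 𝓘(ℝ, EuclideanSpace ℝ (Fin 3)) 𝓘(ℝ, EuclideanSpace ℝ (Fin 4)) Γ p (EuclideanSpace.single (2 : Fin 3) (1 : ℝ))) * Literature.Geometry.Symplectic.det4 (gradient (Literature.Topology.FourManifolds.LefschetzBase.rho g) (ηs p)) (mfderiv 𝓘(ℝ, EuclideanSpace ℝ (Fin 3)) 𝓘(ℝ,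 EuclideanSpace ℝ (Fin 4)) ηs p (EuclideanSpace.single (0 : Fin 3) (1 : ℝ))) (mfderiv 𝓘(ℝ, EuclideanSpace ℝ (Fin 3)) 𝓘(ℝ, EuclideanSpace ℝ (Fin 4)) ηs p (EuclideanSpace.single (1 : Fin 3) (1 : ℝ))) (mfderiv 𝓘(ℝ, EuclideanSpace ℝ (Fin 3)) 𝓘(ℝ, EuclideanSpace ℝ (Fin 4)) ηs p (EuclideanSpace.single (2 : Fin 3) (1 : ℝ))) :=
  fun _ _ _ _ _ _ _ _ D bX _ Ψ hpage R hρR j _ hL p hslit hp hflat =>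
    beltChar_glued_sign D bX Ψ R j hpage hρR hL p hslit hp hflat

end Summit.SmoothPoincare4.SmoothPoincare4.Theorems.AcyclicBisectionExists.ModpBraidOrbits

end
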